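import Literature.AlgebraicGeometry.Frobenioids.PerfectionGroupification
import Literature.AnabelianGeometry.EtaleTheta.Discharge.Sec4Prop42SubRootCoverLaws

/-!
# [EtTh] Prop 4.2 (iii): the tempered-meromorphic ROOT LAW `hR` (GAP G-w4d044-3) at the canonical model REDUCED to
# the root law for the base-field-theoretic rational functions `B₀^Λ` (Def 3.3 (iii) / 3.6 (i))

Mochizuki, *The étale theta function …*, Publ. RIMS **45** (2009), §3 Def 3.6 (i)(ii) PDF pp.76–77 («`B := B₀^Λ|_D
×_{(Φ^{ℝ-log})^gp} Φ^gp`»), §4 Prop 4.2 (iii) proof PDF p.89 L77–80 (ERRATUM E2 «tempered-meromorphic»)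
[cite: MochizukiEtTh2009, Prop 4.2 p.89].  abc-iut cell, layer L2, plan/L2/SUBDAG-EtTh-Prop42.md row L01a /
plan/GAP-LEDGER.md G-w4d044-3 (L2-lead 07:54:26Z: «hR at mkOfModelCanonical — proof-only reduction or exact
missing-datum census»).  Seat abc-iut-w4-d044 (gen 3).  PROOF-ONLY (0 `def`s); nothing landed is edited.

At the canonical model the rational-function functor is NOT free: abc-iut-L2-t3's `TemperedFrobenioid.ratFn A` is
the fibre product of the base-field-theoretic rational functions `T.BΛ(Y_A)` (Def 3.6 (i): `B₀^Λ ∈ {B₀, B₀^pf,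
ℝ·Φ₀^birat}`, `B₀` = the log-meromorphic functions of Def 3.3 (iii) — the HOME of ERRATUM E2) with `Φ(A)^gp` over
`(Φ^{ℝ-log})^gp(A)`.  Hence (`TemperedFrobenioid.rootLaw_of_baseRootLaw`):

  `hR` («every `f ∈ B(A)` has an `N`-th root over some Galois `A' ⟶ A`»)
    ⇐ `hR₀` («every `b ∈ B₀^Λ(Y_A)` has an `N`-th root in `B₀^Λ(Y_{A'})` over some Galois `A' ⟶ A` of `D`»)
     + `Φ` perfect (the §4 setting's standing hypothesis `hP`: `N`-th roots exist uniquely in `Φ(A')`, hence in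
       `Φ(A')^gp` — abc-iut-L1's `isPerfect_grothendieckGroup`)
     + `hTF`: `N`-th powers are injective in `(Φ^{ℝ-log})^gp(A') = (Φ₀^ℝ(Y_{A'}))^gp` (the realification
       `Φ₀^rlf` is an `ℝ_{≥0}`-module, [FrdI] Def 2.4 (i); at an ABSTRACT [FrdI] vocabulary `V` this is a law —
       `RealifiedDivisorMonoids.isRealification` is a stub predicate — recorded as such).
The divisor component of the root is THE `N`-th root of `Φ(Base)^* ξ` in the perfect group `Φ(A')^gp`; the fibre
product condition for it holds because both `Div^Λ` of the `B₀^Λ`-root and its image are `N`-th roots of the same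
element of `(Φ^{ℝ-log})^gp(A')` (naturality `divΛ_natural`, `ΦgpToRlog_pull`), equal by `hTF`.

Consequence (`BiKummerSetting.Prop42Sub.prop42_iii_iv_mkOfModelCanonical_of_baseRootLaw`): the Prop 4.2 (iii) ∧ (iv)
floor of p428253 with `hR` replaced by {`hR₀`, `hTF`}.  D-row: G-w4d044-3 «REDUCED to the B₀^Λ-level root law
hR₀ (+ hTF at abstract V)»; hR₀ is exactly what the `B₀` ↔ `LogDivisorModel.temperedMero` identification
(abc-iut-L2-t10 / L2-t3) must supply.  HONEST FRAMING: refereed pre-IUT material; binders, not new `Prop` defs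
(D-0067 (5)); nothing here bears on [IUTchIII] Cor. 3.12.
-/

noncomputable section

namespace Literature.AnabelianGeometry.EtaleTheta

open CategoryTheory Opposite Literature.AlgebraicGeometry.Frobenioids

universe u₀ v₀ u v w

variable {K : Type u₀} [Field K]

namespace TemperedFrobenioid

variable {D₀ : Type u₀} [Category.{v₀} D₀] {V : FrdIMonoidStub.{w}} {T : RealifiedDivisorMonoids (D₀ := D₀) V}
  {D : Type u} [Category.{v} D] {VD : FrdICatStub.{u, v, w} D} (tf : TemperedFrobenioid T D VD)

/-- **The root law for `B = B₀^Λ|_D ×_{(Φ^{ℝ-log})^gp} Φ^gp` from the root law for `B₀^Λ`** (Def 3.6 (i)(ii)):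
if every `b ∈ B₀^Λ(Y_A)` acquires an `N`-th root over some (`IG`-)cover `A' ⟶ A` of `D` (`hR₀`), `Φ` is perfect
(`hP`) and `N`-th powers are injective in `(Φ^{ℝ-log})^gp` (`hTF`), then every `f ∈ B(A)` acquires an `N`-th root
over some `IG`-cover — the binder `hR` of `Prop42Sub.rootOverCovering_mkOfModelCanonical_of_laws` (G-w4d044-3).
[cite: MochizukiEtTh2009, Def 3.6 p.77] -/
theorem rootLaw_of_baseRootLaw (IG : D → Prop) (hP : ∀ A : Dᵒᵖ, IsPerfect (tf.Φ.carrier A))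
    (hTF : ∀ (A : D) (N : ℕ), 0 < N →
      Function.Injective fun x : Algebra.GrothendieckGroup (T.ΦR.obj (op (tf.base.obj A))) => x ^ N)
    (hR₀ : ∀ (N : ℕ+) (A : D), IG A → ∀ b : T.BΛ.obj (op (tf.base.obj A)),
      ∃ (A' : D) (_ : IG A') (c : A' ⟶ A) (b' : T.BΛ.obj (op (tf.base.obj A'))),
        b' ^ (N : ℕ) = (T.BΛ.map (tf.base.map c).op).hom b)
    (N : ℕ+) (A : D) (hA : IG A) (f : tf.ratFnFunctor.obj (op A)) :
    ∃ (A' : D) (_ : IG A') (c : A' ⟶ A) (g : tf.ratFnFunctor.obj (op A')),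
      g ^ (N : ℕ) = pull tf.ratFnFunctor c f := by
  obtain ⟨A', hA', c, b', hb'⟩ := hR₀ N A hA f.1.1
  -- the divisor component: THE `N`-th root of `Φ(Base c)^* ξ` in the perfect group `Φ(A')^gp`
  have hPgp : IsPerfect (Algebra.GrothendieckGroup (tf.Φ.carrier (op A'))) := isPerfect_grothendieckGroup (hP (op A'))
  let ξ₁ : Algebra.GrothendieckGroup (tf.Φ.carrier (op A')) := gpMap (tf.Φ.pull c.op) f.1.2
  let η : Algebra.GrothendieckGroup (tf.Φ.carrier (op A')) := hPgp.root N ξ₁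
  have hη : η ^ (N : ℕ) = ξ₁ := hPgp.root_pow N ξ₁
  -- the fibre-product condition for `(b', η)`: both sides are `N`-th roots of `Div^Λ(Base(c)^* b)`
  have hmem : T.divΛ (tf.baseOp (op A')) b' = tf.ΦgpToRlog (op A') η := by
    apply hTF A' N N.pos
    change T.divΛ (tf.baseOp (op A')) b' ^ (N : ℕ) = tf.ΦgpToRlog (op A') η ^ (N : ℕ)
    rw [← map_pow, ← map_pow, hb', hη, T.divΛ_natural, f.2]
    exact (tf.ΦgpToRlog_pull c.op f.1.2).symm
  refine ⟨A', hA', c, ⟨(b', η), hmem⟩, ?_⟩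
  apply Subtype.ext
  change ((b', η) : (T.BΛ.obj (tf.baseOp (op A')) : Type w) × _) ^ (N : ℕ) = _
  rw [Prod.pow_mk, hb', hη]
  rfl

end TemperedFrobenioid

namespace BiKummerSetting

section Canonical

variable (X : SemiGraphs.TemperedArithmeticGroup.{u₀} K) {D₀ : Type u₀}
  [Category.{v₀} D₀] {V : FrdIMonoidStub.{w}} {T : RealifiedDivisorMonoids (D₀ := D₀) V}
  {D : Type u} [Category.{v} D] {VD : FrdICatStub.{u, v, w} D}
  (tf : TemperedFrobenioid T D VD) (hZ : tf.monoidType = MonoidType.Z)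
  (hP : ∀ A : Dᵒᵖ, IsPerfect (tf.Φ.carrier A)) (IG : D → Prop) (gS : ∀ A : D, IG A → (X.Pi →* Aut A))
  (gSs : ∀ (A : D) (h : IG A), Function.Surjective (gS A h))
  (NH : Subgroup (Field.absoluteGaloisGroup K) → tf.category → ℕ+ → Prop) (A₀ : tf.category)
  (hA₀ : PreFrobenioid.IsFrobeniusTrivial tf.toElem A₀) (hA₀' : IG A₀.base)

/-- **[EtTh] Prop 4.2 (iii) ∧ (iv) AS TYPED at the canonical model, the root law `hR` (G-w4d044-3) REPLACED by the
`B₀^Λ`-level root law `hR₀` + injectivity of `N`-th powers in `(Φ^{ℝ-log})^gp` (`hTF`)** — p428253's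
`prop42_iii_iv_mkOfModelCanonical_of_laws` with `hR := tf.rootLaw_of_baseRootLaw IG hP hTF hR₀` (`Φ` perfect is the
setting's own `hP`). [cite: MochizukiEtTh2009, Prop 4.2 p.88] -/
theorem Prop42Sub.prop42_iii_iv_mkOfModelCanonical_of_baseRootLaw
    (hΦd : Objectwise (fun M _ => IsDivisorial M) tf.divisorMonoid)
    (hDSpull : ∀ {A A' : D} (e : A' ⟶ A) {a b : tf.Φ.carrier (op A)},
      (∀ x : tf.Φ.carrier (op A), x ∣ a → x ∣ b → x = 1) →
        ∀ y : tf.Φ.carrier (op A'), y ∣ pull tf.divisorMonoid e a → y ∣ pull tf.divisorMonoid e b → y = 1)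
    (hTF : ∀ (A : D) (N : ℕ), 0 < N →
      Function.Injective fun x : Algebra.GrothendieckGroup (T.ΦR.obj (op (tf.base.obj A))) => x ^ N)
    (hR₀ : ∀ (N : ℕ+) (A : D), IG A → ∀ b : T.BΛ.obj (op (tf.base.obj A)),
      ∃ (A' : D) (_ : IG A') (c : A' ⟶ A) (b' : T.BΛ.obj (op (tf.base.obj A'))),
        b' ^ (N : ℕ) = (T.BΛ.map (tf.base.map c).op).hom b)
    (hE : ∀ (N : ℕ+) (A' : tf.category), PreFrobenioid.IsFrobeniusTrivial tf.toElem A' → IG A'.base →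
      ∃ (A'' : tf.category) (ψ : A'' ⟶ A'), PreFrobenioid.IsPullbackMorphism tf.toElem ψ ∧ IG A''.base ∧
        tf.IsMuSaturated A'' N ∧ NH (mkOfModelCanonical X tf hZ hP IG gS gSs NH A₀ hA₀ hA₀').HodotBsFld A'' N)
    (hS : ∀ ⦃A B : D⦄ (hA : IG A) (hB : IG B) (b : B ⟶ A),
      ∃ c : X.Pi, ∀ g : X.Pi, (gS B hB g).hom ≫ b = b ≫ (gS A hA (c * g * c⁻¹)).hom)
    (hL : ∀ (A'' : tf.category) (N : ℕ+) (g : A''.base ⟶ A₀.base)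
      (ξ : tf.ratFnFunctor.obj (op A₀.base)),
      PreFrobenioid.IsFrobeniusTrivial tf.toElem A'' →
      NH (mkOfModelCanonical X tf hZ hP IG gS gSs NH A₀ hA₀ hA₀').HodotBsFld A'' N →
      divB tf.divisorMonoid tf.ratFnFunctor tf.divBNatTrans (op A₀.base) ξ = 1 →
        ∃ ζ : tf.ratFnFunctor.obj (op A''.base), ζ ^ (N : ℕ) = pull tf.ratFnFunctor g ξ) :
    (mkOfModelCanonical X tf hZ hP IG gS gSs NH A₀ hA₀ hA₀').Prop42_iii (fun {_ _} φ x => tf.pullFracModel φ x) ∧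
      (mkOfModelCanonical X tf hZ hP IG gS gSs NH A₀ hA₀ hA₀').Prop42_iv (fun φ x => tf.pullFracModel φ x) :=
  Prop42Sub.prop42_iii_iv_mkOfModelCanonical_of_laws X tf hZ hP IG gS gSs NH A₀ hA₀ hA₀' hΦd hDSpull
    (tf.rootLaw_of_baseRootLaw IG hP hTF hR₀) hE hS hL

end Canonical

end BiKummerSetting

end Literature.AnabelianGeometry.EtaleTheta

end
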